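import Literature.NumberTheory.LFunctions.CentralValueFamilyForcedSplitTotal
import Literature.NumberTheory.LFunctions.IwaniecSarnakFamilyWeightTwoPB
import HarnessLib

/-!
# The forced split at result level, weight `2`, prime level — RE-THREADED to the printed range of the
# Petersson bound (`kowalskiMichel2000_peterssonBound`, R2-G44)

Topic `Literature/NumberTheory/LFunctions` (namespace
`Literature.NumberTheory.LFunctions.CentralValueFamilyHalfEdge`). PROVED; NO named fact (D-0026).
Companion («`_pb` twin») of `CentralValueFamilyForcedSplitTotal.lean`: its weight-2 prime-level
proportion form `goodMass_le_half_weightTwo_prime` carries the binder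
`(hP : KowalskiMichel2000.kowalskiMichel2000_petersson)` — FALSE AS TYPED at `(m,n) = (q,q)`
(`KowalskiMichel2000.not_kowalskiMichel2000_petersson`, cell record R2-G44; «refuted-as-typed ≠
refuted-in-print»). Here it is re-stated verbatim over the fact in its printed range,
`KowalskiMichel2000.kowalskiMichel2000_peterssonBound` (binder `¬ (q ∣ m ∧ q ∣ n)`, KM2000 §2.3 p. 310
display after (16) with §2.4.2 (23)), the even share coming from the re-threaded
`evenShare_primeLevelFamilyTwo_pb` (`IwaniecSarnakFamilyWeightTwoPB`). Old decl untouched; no use of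
the negated fact (smuggling rule).
«The programme SEARCHES and TYPES; no claim about Landau–Siegel zeros, Theorems 1–2 of arXiv:2211.02515
or a repaired Margin232 until a kernel theorem says so.»

## References

* [IwaniecConversations2006] §7 (7.3)–(7.7), p. 97.
* [KowalskiMichel2000] §2.3 display after (16) IN ITS RANGE (§2.4.2 (23)); Lemma 1.
-/

noncomputable section

namespace Literature.NumberTheory.LFunctions.CentralValueFamilyHalfEdge

open scoped MatrixGroups
open Finset Real CongruenceSubgroup
open Literature.NumberTheory.EllipticCurves.ModularForms
open Literature.NumberTheory.LFunctions.IwaniecSarnak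

/-- **T-fam-KILL-2, result level, PROPORTION FORM at prime level and weight `2` — all hypotheses typed
print, the Petersson fact IN ITS PRINTED RANGE** (re-thread of `goodMass_le_half_weightTwo_prime`,
R2-G44): with `lapidRallis2003_theorem1_gl2Twist`, `iwaniec2006_twistedHalf`,
`iwaniec2006_mixedMomentOverMass`, `kowalskiMichel2000_peterssonBound`, `kowalskiMichel2000_lemma1`, for
every `ε > 0` there is `δ > 0` such that for all large PRIME levels `q` and all real primitive
`χ mod D`, `1 < D ≤ q^δ`, `(q,D) = 1`, `χ(−q) = 1`: `Σ^h_{w_f = 1, L(½,f) ≥ (log q)⁻²} ω_f ≤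
(½ + ε + C·L(1,χ)·(log q)⁴)·Σ^h_{w_f = 1} ω_f` over `H_2(q)`. [cite: IwaniecConversations2006, §7 p. 97] -/
theorem goodMass_le_half_weightTwo_prime_pb (hLR : lapidRallis2003_theorem1_gl2Twist)
    (hTw : iwaniec2006_twistedHalf) (hMix : iwaniec2006_mixedMomentOverMass)
    (hP : KowalskiMichel2000.kowalskiMichel2000_peterssonBound)
    (hL : KowalskiMichel2000.kowalskiMichel2000_lemma1) {ε : ℝ} (hε : 0 < ε) :
    ∃ C : ℝ, 0 < C ∧ ∃ δ : ℝ, 0 < δ ∧ ∃ s₀ : ℝ, ∀ N : ℕ+, (N : ℕ).Prime →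
      s₀ ≤ ((N : ℕ) : ℝ) →
        ∀ (D : ℕ) [NeZero D] (χ : DirichletCharacter ℂ D), χ.IsPrimitive → MulChar.IsQuadratic χ →
          1 < D → (D : ℝ) ≤ ((N : ℕ) : ℝ) ^ δ → (N : ℕ).Coprime D ∧ χ (-((N : ℕ) : ZMod D)) = 1 →
            harmonicSum (N : ℕ) 2
                (fun f => if rootNumber f = 1 ∧ (Real.log (N : ℕ))⁻¹ ^ 2 ≤ (centralValue f).re
                  then 1 else 0) ≤
              (1 / 2 + ε + C * (χ.LFunction 1).re * Real.log ((N : ℕ) : ℝ) ^ 4) *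
                harmonicSum (N : ℕ) 2 (fun f => if rootNumber f = 1 then 1 else 0) := by
  have hk : (2 : ℤ) ≤ 2 := le_rfl
  have hkev : Even (2 : ℤ) := ⟨1, rfl⟩
  obtain ⟨δ₁, hδ₁, htot⟩ := mixedOverTotalMass_iwaniecSarnakFamily hk hkev hMix
  obtain ⟨δ₂, hδ₂, htw⟩ := TwistedHalf_of_twistedProportion hε (hTw 2 hk hkev)
  have htot' : primeLevelFamilyTwo.MixedOverTotalMass (min δ₁ δ₂) :=
    CentralValueFamily.refine_mixedOverTotalMass (htot.anti (min_le_left _ _))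
  have htw' : primeLevelFamilyTwo.TwistedHalf (1 / 2 - ε) 2 (min δ₁ δ₂) :=
    CentralValueFamily.refine_twistedHalf (htw.anti (min_le_right _ _))
  have hnn := primeLevelFamilyTwo_nonnegOn hLR
  obtain ⟨C, hC, s₀, hs₀⟩ := primeLevelFamilyTwo.goodMass_le_of_mixedOverMass hnn
    (CentralValueFamily.mixedOverMass_of_total hnn
      (fun _ _ _ _ hc => CentralValueFamily.refine_compatible_B hc)
      (evenShare_primeLevelFamilyTwo_pb hP hL) htot') htw'
  refine ⟨C, hC, min δ₁ δ₂, lt_min hδ₁ hδ₂, s₀,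
    fun N hprime hN D _ χ hprim hquad hD hDle hcomp => ?_⟩
  have h := hs₀ N ⟨hprime.squarefree, hprime⟩ hN D χ hprim hquad hDle ⟨hcomp, hD⟩
  rw [CentralValueFamily.refine_goodMass, CentralValueFamily.refine_evenMass,
    CentralValueFamily.refine_size, goodMass_iwaniecSarnakFamily N, evenMass_iwaniecSarnakFamily N] at h
  have e : (1 - (1 / 2 - ε) : ℝ) = 1 / 2 + ε := by ring
  simpa only [e, show (2 * 2 : ℕ) = 4 from rfl] using h

end Literature.NumberTheory.LFunctions.CentralValueFamilyHalfEdge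

end
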